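/-
Copyright (c) 2026 the pub-hodgecm-mathlib formalisation cell (harness21).  Prover seat hodgecm-mathlib-K2E3-p37 (g2), Track B «K2-LIT» ∕ h413 =
`stmt-HodgeConjecture-24833`, line `K2_E3_EllipticInputs`, unit U4 «Keys», PART «U4Keys» socket :182 (U4f-χ₁-ram-one-pos)
`sig_K2E3KeysThmTwoContractingRamifiedCharOnePosDepth` (L4 line-lead K2E3-plan (g5); regime A_pos^{<}, two-depth bricks ★ D174 p862387, ★ p862449∕p862455, ★ p862537, ★ p862593):
brick (iii)^{<}-cover «EVERY INTERMEDIATE LOWER CELL OF THE TWO-DEPTH GROUP CARRIES A DEPTH WITNESS» — the case analysis (family X ∪ family Z of ★ p862593) for Roche-type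
exponents `r + r′ = n`, `s + s′ = c`, `|r − r′| ≤ 1`, `|s − s′| ≤ 1` aligned, both orientations (so the `w`-swapped chart of the upper shells is served by the same theorem).
REPORT-FIRST 2026-09-04.
-/
import Summits.HodgeConjecture.HodgeConjecture.Theorems.K2E3TwoDepthDepthWitness        -- ★ p862593 (this seat): `exists_familyX_witness_twoDepth`, `exists_familyZ_witness_twoDepth`; brings ★ D174 (`test_twoDepth_iff`), ★ p862372, ★ X∕Z, ★ p861919
import HarnessLib

/-!
# K2 ∕ E3 «EllipticInputs», unit U4 «Keys» — (U4f-χ₁-ram-one-pos), regime A_pos^{<}, brick (iii)^{<}-cover: THE COVER OF THE INTERMEDIATE LOWER CELLS OF `J_e` BY FAMILIES X ∪ Z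
# «`|z| ≤ 1`, `ū(x,z) ∉ J_e`, `ū(x,z) ∉ P·w·J_e` ⟹ the regime of family X or of family Z holds — for `r + r′ = n`, `s + s′ = c ≤ n`, `|r − r′|, |s − s′| ≤ 1` aligned»
# [Roche1998 §3–§4; BruhatTits1972 (6.4.9); Casselman1995 §6.3; Serre1979 II §1]

Cell hodgecm-mathlib, Track B «K2-LIT», crux item H413 = stmt-HodgeConjecture-24833 (route `HCCMUnconditional`, no route verbs); target BY NAME the OPEN tier-0 leaf
`…K2E3EllipticInputs.U4Keys.sig_K2E3KeysThmTwoContractingRamifiedCharOnePosDepth` (U4Keys ED. 8 :182), design D-I at POSITIVE depth, regime A_pos^{<}.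
Author K2E3-p37 (g2).  `--supports stmt-HodgeConjecture-24833 --as helper`; THEOREMS ONLY; MODEL level.  NOT THE PAYER.  The twin of ★ p862085 (`K2E3LevelNDepthWitnessCover`,
uniform `J_{m+1}`) for the two-depth group.

THE POINT.  ★ p862593 gives the two witness families on `J_e`, `e = (r, s; r′, s′)`, under MONOMIAL regimes.  This file proves that the regimes COVER every intermediate lower
cell: `ū = ū(x, z)` with `|z| ≤ 1` (hence `|x| ≤ 1`), NOT in `J_e` (entry form: `¬(|x| ≤ |ϖ|^{r′} ∧ |z| ≤ |ϖ|^{s′})`) and NOT in the sharp big cell `P·w·J_e` (entry form of ★ p862537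
`K2E3LowerUnipotentDeepCellTwoDepth.exists_borel_mul_weylLongU_mul_mem_of_v_div_le`: `¬(|x∕z| ≤ |ϖ|ʳ ∧ |ϖ|^{−s} ≤ |z|)`), for exponents with `r + r′ = m + 1` (= cond_E),
`s + s′ = k + 1` (= cond_F ≤ cond_E), `|r − r′| ≤ 1`, `|s − s′| ≤ 1` and ALIGNED (`r ≤ r′ ∧ s ≤ s′` or `r′ ≤ r ∧ s′ ≤ s` — Roche's `(⌊n∕2⌋, ⌊c∕2⌋; ⌈n∕2⌉, ⌈c∕2⌉)` and its
`w`-swap; the mixed orientations FAIL at `c = 1`, `n` odd: the cell `|z| = 1`, `|x| = |ϖ|^{⌊n∕2⌋}` is then neither X nor Z).  The proof reads `|x| = exp ℓ_x`, `|z| = exp ℓ_z` in `ℤᵐ⁰`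
and the whole case analysis is ONE linear-arithmetic fact (`cover_arith`, `omega`; checked beforehand by brute force over `n ≤ 12`): off-`J_e` via `x` ⟹ X (`ord x ≤ r′ − 1 ≤ r`),
off via `z` only ⟹ Z (`ord z ≤ s′ − 1` forces `s′ ≥ 2`, `k ≥ 1`), the layer `|z| = 1` splitting between X (`ord x ≤ ⌊n∕2⌋ − 1`) and Z (`ord x ≥ ⌊n∕2⌋`, `c ≥ 2`) or the sharp
big cell (`c ≤ 1`).  OUTPUT: `∃ u ∈ N`, `ū⁻¹uū ∈ J_e`, `(ū⁻¹uū)₀₀ = (1 + c)(1 + ε)`, `|ε| ≤ |ϖ|^{m+1}`, with `c ∈ {c₁, c₂}` — `c₁` ANY element of `𝔭ᵐ` (feed the cond_E witness: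
`χ₁(1 + c₁) ≠ 1`), `c₂` a `σ`-FIXED element of `𝔭ᵏ` (the cond_F witness) — so `θ(ū⁻¹uū) = χ₁(1 + c) ≠ 1 = (χδ^{½})(u)` either way (★ p862449 reads `θ` on `J_e`).
* §1 `cover_arith`, `cover_arith_zero` (pure `omega`), `v_pow_eq_exp`.
* §2 `not_le_and_le_of_not_mem_twoDepth` (`ū ∉ J_e` in entry form) and **`exists_depth_witness_twoDepth`**.
HONEST LABEL: HC_CM is proved only modulo the 7 printed citations (2 remaining named inputs: hLiu418 = stmt-HodgeConjecture-24832, h413 = stmt-HodgeConjecture-24833)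
until rung 0 closes; count-neutral — this file does NOT pay the leaf; no printed citation is discharged.

## References
* [Roche1998] A. Roche, *Types and Hecke algebras for principal series representations of split reductive p-adic groups*, Ann. Sci. ÉNS (4) 31 (1998), §3–§4.
* [BruhatTits1972] F. Bruhat, J. Tits, *Groupes réductifs sur un corps local I*, Publ. Math. IHÉS 41 (1972), (6.4.9).
* [Casselman1995] W. Casselman, *Introduction to the theory of admissible representations of `p`-adic reductive groups* (1995), §6.3.
* [Serre1979] J.-P. Serre, *Local Fields*, GTM 67 (1979), Ch. II §1.
-/

set_option autoImplicit false
-- the mandated namespace repeats the single-problem summit's segment (`HodgeConjecture.HodgeConjecture`)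
set_option linter.dupNamespace false

noncomputable section

open Matrix Literature.NumberTheory.Automorphic Literature.NumberTheory.Automorphic.UnitaryGroup
open scoped Matrix MatrixGroups WithZero Pointwise

namespace Summit.HodgeConjecture.HodgeConjecture.Cruxes.H413.K2E3TwoDepthDepthWitnessCover

open Summit.HodgeConjecture.HodgeConjecture.Cruxes.H413
open Summit.HodgeConjecture.HodgeConjecture.Cruxes.H413.K2E3TwoDepthDepthWitness

/-! ## §1 The arithmetic of the cover -/

/-- **THE COVER, AS LINEAR ARITHMETIC** (`ℓ_x = log|x|`, `ℓ_z = log|z|`, `x ≠ 0`): under Roche-type exponent relations, `|z| ≤ 1`, `|x|² ≤ |z|`, off-`J_e` and off the sharp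
big cell, either the X-regime or the Z-regime inequalities of ★ p862593 hold.  (`omega`; brute-forced beforehand for `n ≤ 12`; the ALIGNMENT hypothesis is necessary.)
[cite: Roche1998, §4] [cite: Serre1979, Ch. II §1] -/
theorem cover_arith {r s r' s' m k : ℕ} {lx lz : ℤ} (hm : 1 ≤ m) (hkm : k ≤ m) (hrr : r + r' = m + 1) (hss : s + s' = k + 1)
    (hr1 : r ≤ r' + 1) (hr2 : r' ≤ r + 1) (hs1 : s ≤ s' + 1) (hs2 : s' ≤ s + 1) (hal : (r ≤ r' ∧ s ≤ s') ∨ (r' ≤ r ∧ s' ≤ s))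
    (hz0 : lz ≤ 0) (hxx : lx + lx ≤ lz) (hoff : ¬ (lx ≤ -(r' : ℤ) ∧ lz ≤ -(s' : ℤ)))
    (hshal : ¬ (lx + -lz ≤ -(r : ℤ) ∧ -(-(s : ℤ)) ≤ lz)) :
    (-(m : ℤ) ≤ -(r : ℤ) + lx ∧ -(m : ℤ) + lz ≤ -(r' : ℤ) + lx ∧ -(m : ℤ) + lz ≤ -(1 : ℤ) + (lx + lx) ∧
        r' ≤ m ∧ s' ≤ m ∧ s ≤ 2 * r ∧ s' ≤ 2 * r') ∨
      (1 ≤ k ∧ -(k : ℤ) ≤ -(s : ℤ) + lz ∧ -(k : ℤ) + lx ≤ -(r : ℤ) + lz ∧ -(k : ℤ) + lx ≤ -(r' : ℤ) ∧ -(k : ℤ) + lz ≤ -(s' : ℤ) ∧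
        -(k : ℤ) + (lx + lx) ≤ -((m : ℤ) + 1) + lz) := by
  omega

/-- The `x = 0` column of the cover: off-`J_e` via `z`, off the sharp big cell ⟹ the Z-regime (`1 ≤ k`, `|ϖ|ᵏ ≤ |ϖ|ˢ|z|`, `|ϖ|ᵏ|z| ≤ |ϖ|^{s′}`). [cite: Roche1998, §4] -/
theorem cover_arith_zero {s s' k : ℕ} {lz : ℤ} (hss : s + s' = k + 1) (hoff : ¬ lz ≤ -(s' : ℤ)) (hshal : ¬ -(-(s : ℤ)) ≤ lz) :
    1 ≤ k ∧ -(k : ℤ) ≤ -(s : ℤ) + lz ∧ -(k : ℤ) + lz ≤ -(s' : ℤ) := by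
  omega

section Valuation

variable {K : Type*} [Field K] [Valued K ℤᵐ⁰] [ValuativeRel K] [(Valued.v : Valuation K ℤᵐ⁰).Compatible]
  (σ : K →+* K) {ϖ : K} {J : Matrix (Fin 3) (Fin 3) K} (hJ : J = (StdForm.antidiagonal 3).over K)
  (hσ : ∀ a, σ (σ a) = a) (hvσ : ∀ a, Valued.v (σ a) = Valued.v a) (hvϖ : Valued.v ϖ = WithZero.exp (-1 : ℤ))
  (r s r' s' : ℕ) (Jg : Subgroup ↥(unitaryGroupOfForm σ J))
  (hJg : ∀ k, k ∈ Jg ↔ ∀ i j, Valued.v (((k : GL (Fin 3) K) : Matrix (Fin 3) (Fin 3) K) i j) ≤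
    Valued.v ϖ ^ (![![0, r, s], ![r', 0, r], ![s', r', 0]] : Fin 3 → Fin 3 → ℕ) i j)

omit [ValuativeRel K] [(Valued.v : Valuation K ℤᵐ⁰).Compatible] in
include hvϖ in
/-- `|ϖ|ⁿ = exp(−n)` in `ℤᵐ⁰`. [cite: Serre1979, Ch. II §1] -/
theorem v_pow_eq_exp (n : ℕ) : Valued.v ϖ ^ n = WithZero.exp (-(n : ℤ)) := by
  rw [hvϖ, ← WithZero.exp_nsmul, smul_neg, nsmul_eq_mul, mul_one]

/-! ## §2 The cover -/

include hJ hvσ hvϖ hJg in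
/-- **`ū(x, z) ∉ J_e` ON THE ENTRIES**: for an integral lower unipotent `ū(x, z)`, non-membership in the two-depth group means `¬(|x| ≤ |ϖ|^{r′} ∧ |z| ≤ |ϖ|^{s′})` (★ D174
`test_twoDepth_iff` read on `(1,0) = −σx`, `(2,1) = x`, `(2,0) = z`; the upper entries vanish). [cite: Roche1998, §3] [cite: BruhatTits1972, (6.4.9)] -/
theorem not_le_and_le_of_not_mem_twoDepth {nb : ↥(unitaryGroupOfForm σ J)} {x z : K}
    (hnb : ((nb : GL (Fin 3) K) : Matrix (Fin 3) (Fin 3) K) = !![1, 0, 0; -σ x, 1, 0; z, x, 1])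
    (hx1 : Valued.v x ≤ 1) (hz1 : Valued.v z ≤ 1) (hoff : nb ∉ Jg) :
    ¬ (Valued.v x ≤ Valued.v ϖ ^ r' ∧ Valued.v z ≤ Valued.v ϖ ^ s') := by
  have hvϖ1 : Valued.v ϖ ≤ 1 := by rw [hvϖ, ← WithZero.exp_zero, WithZero.exp_le_exp]; norm_num
  have hnbK : (nb : GL (Fin 3) K) ∈ glInt 3 K := mem_glInt_of_coe_eq_lower σ hJ hvσ hnb hx1 hz1
  rintro ⟨hxn, hzn⟩
  apply hoff
  rw [hJg, K2E3IwahoriTwoDepthFactorisation.test_twoDepth_iff σ hvϖ1 r s r' s']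
  refine ⟨(mem_glInt_subgroupOf_iff σ hJ hvσ _).1 (Subgroup.mem_subgroupOf.2 hnbK), ?_, ?_, ?_, ?_, ?_, ?_⟩
  · rw [hnb]; simp
  · rw [hnb]; simp
  · rw [hnb]; simp
  · rw [hnb]; simpa [Valuation.map_neg, hvσ] using hxn
  · rw [hnb]; simpa using hxn
  · rw [hnb]; simpa using hzn

include hJ hσ hvσ hvϖ hJg in
/-- **DEPTH WITNESS ON EVERY INTERMEDIATE LOWER CELL OF `J_e` (families X ∪ Z, ★ p862593).**  Exponents: `r + r′ = m + 1`, `s + s′ = k + 1`, `k ≤ m`, `1 ≤ m`, `|r − r′| ≤ 1`,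
`|s − s′| ≤ 1`, aligned.  `ū ∈ U(σ, Φ₃)` with matrix `ū(x, z)` (`z + σz + xσx = 0`), `|z| ≤ 1`, off `J_e` (`¬(|x| ≤ |ϖ|^{r′} ∧ |z| ≤ |ϖ|^{s′})`) and off the sharp big cell
(`¬(|x∕z| ≤ |ϖ|ʳ ∧ |ϖ|^{−s} ≤ |z|)`, ★ p862537's letters negated); `c₁ ∈ 𝔭ᵐ` arbitrary, `c₂ ∈ 𝔭ᵏ` `σ`-fixed; a trace-one `t`.  Then some `u ∈ N` has `ū⁻¹ u ū ∈ J_e` and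
`(ū⁻¹ u ū)₀₀ = (1 + c)(1 + ε)` with `|ε| ≤ |ϖ|^{m+1}` and `c = c₁` (family X) or `c = c₂` (family Z).  With `χ₁(1 + c₁) ≠ 1` (cond_E `= m + 1`) and `χ₁(1 + c₂) ≠ 1` (cond_F `= k + 1`)
this is the letter `hwit` of ★ p861573 on the lower intermediate cells of `J_e`; the upper shells are the same theorem for the swapped exponents `(r′, s′; r, s)` (also aligned)
after the `w`-transport. [cite: Roche1998, §3–§4] [cite: Casselman1995, §6.3] [cite: BruhatTits1972, (6.4.9)] [cite: Serre1979, Ch. II §1] -/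
theorem exists_depth_witness_twoDepth {m k : ℕ} (hm : 1 ≤ m) (hkm : k ≤ m) (hrr : r + r' = m + 1) (hss : s + s' = k + 1)
    (hr1 : r ≤ r' + 1) (hr2 : r' ≤ r + 1) (hs1 : s ≤ s' + 1) (hs2 : s' ≤ s + 1) (hal : (r ≤ r' ∧ s ≤ s') ∨ (r' ≤ r ∧ s' ≤ s))
    {nb : ↥(unitaryGroupOfForm σ J)} {x z c₁ c₂ t : K}
    (hnb : ((nb : GL (Fin 3) K) : Matrix (Fin 3) (Fin 3) K) = !![1, 0, 0; -σ x, 1, 0; z, x, 1]) (hrel : z + σ z + x * σ x = 0)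
    (hz1 : Valued.v z ≤ 1)
    (hoff : ¬ (Valued.v x ≤ Valued.v ϖ ^ r' ∧ Valued.v z ≤ Valued.v ϖ ^ s'))
    (hshal : ¬ (Valued.v (x / z) ≤ Valued.v ϖ ^ r ∧ (Valued.v ϖ ^ s)⁻¹ ≤ Valued.v z))
    (hc₁ : Valued.v c₁ ≤ Valued.v ϖ ^ m) (hσc₂ : σ c₂ = c₂) (hc₂ : Valued.v c₂ ≤ Valued.v ϖ ^ k) (ht : t + σ t = 1) (hvt : Valued.v t ≤ 1) :
    ∃ u : ↥(unitaryGroupOfForm σ J), u ∈ unipotentU σ J ∧ nb⁻¹ * u * nb ∈ Jg ∧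
      ∃ c ε : K, (c = c₁ ∨ c = c₂) ∧ Valued.v ε ≤ Valued.v ϖ ^ (m + 1) ∧
        (((nb⁻¹ * u * nb : ↥(unitaryGroupOfForm σ J)) : GL (Fin 3) K) : Matrix (Fin 3) (Fin 3) K) 0 0 = (1 + c) * (1 + ε) := by
  have eϖ : ∀ n : ℕ, Valued.v ϖ ^ n = WithZero.exp (-(n : ℤ)) := v_pow_eq_exp hvϖ
  -- `|x|² ≤ |z| ≤ 1`
  have hxx : Valued.v x * Valued.v x ≤ Valued.v z := v_mul_v_le_of_rel σ hvσ hrel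
  have hx1 : Valued.v x ≤ 1 := by
    by_contra h
    rw [not_le] at h
    exact absurd (h.trans_le ((le_mul_of_one_le_right' h.le).trans (hxx.trans hz1))) (lt_irrefl 1)
  -- `z ≠ 0` (else `x = 0` and `ū ∈ J_e`)
  have hz : z ≠ 0 := by
    rintro rfl
    have hx : x = 0 := by
      have h : Valued.v x * Valued.v x ≤ 0 := by rwa [map_zero] at hxx
      exact (Valuation.zero_iff _).1 (mul_self_eq_zero.1 (le_zero_iff.1 h))
    subst hx
    exact hoff ⟨by rw [map_zero]; exact zero_le, by rw [map_zero]; exact zero_le⟩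
  have hvz0 : Valued.v z ≠ 0 := (Valuation.ne_zero_iff _).2 hz
  obtain ⟨lz, ez⟩ : ∃ lz : ℤ, Valued.v z = WithZero.exp lz := ⟨_, (WithZero.exp_log hvz0).symm⟩
  have hz0' : lz ≤ 0 := by
    have h := hz1
    rw [ez, ← WithZero.exp_zero, WithZero.exp_le_exp] at h
    exact h
  rcases eq_or_ne x 0 with hx0 | hx0
  · -- the column `x = 0`: family Z
    subst hx0
    have hoffz : ¬ lz ≤ -(s' : ℤ) := fun h => hoff ⟨by rw [map_zero]; exact zero_le, by rw [ez, eϖ, WithZero.exp_le_exp]; omega⟩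
    have hshalz : ¬ -(-(s : ℤ)) ≤ lz := fun h =>
      hshal ⟨by rw [zero_div, map_zero]; exact zero_le, by rw [eϖ, ← WithZero.exp_neg, ez, WithZero.exp_le_exp]; omega⟩
    obtain ⟨hk1, h1, h2⟩ := cover_arith_zero hss hoffz hshalz
    obtain ⟨u, huN, hj, ε, hε, h00⟩ := exists_familyZ_witness_twoDepth σ hJ hσ hvσ hvϖ r s r' s' Jg hJg (m := m) hk1 hnb hrel hx1 hz1
      (by rw [eϖ, eϖ, ez, ← WithZero.exp_add, WithZero.exp_le_exp]; omega)
      (by rw [map_zero, mul_zero]; exact zero_le)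
      (by rw [map_zero, mul_zero]; exact zero_le)
      (by rw [eϖ, eϖ, ez, ← WithZero.exp_add, WithZero.exp_le_exp]; omega)
      (by rw [map_zero, mul_zero, mul_zero]; exact zero_le)
      hσc₂ hc₂ ht hvt
    exact ⟨u, huN, hj, c₂, ε, Or.inr rfl, hε, h00⟩
  · have hvx0 : Valued.v x ≠ 0 := (Valuation.ne_zero_iff _).2 hx0
    obtain ⟨lx, ex⟩ : ∃ lx : ℤ, Valued.v x = WithZero.exp lx := ⟨_, (WithZero.exp_log hvx0).symm⟩
    have hxx' : lx + lx ≤ lz := by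
      have h := hxx
      rw [ex, ez, ← WithZero.exp_add, WithZero.exp_le_exp] at h
      exact h
    have hoff' : ¬ (lx ≤ -(r' : ℤ) ∧ lz ≤ -(s' : ℤ)) := fun h =>
      hoff ⟨by rw [ex, eϖ, WithZero.exp_le_exp]; omega, by rw [ez, eϖ, WithZero.exp_le_exp]; omega⟩
    have hshal' : ¬ (lx + -lz ≤ -(r : ℤ) ∧ -(-(s : ℤ)) ≤ lz) := fun h =>
      hshal ⟨by rw [map_div₀, ex, ez, eϖ, div_eq_mul_inv, ← WithZero.exp_neg, ← WithZero.exp_add, WithZero.exp_le_exp]; omega,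
        by rw [eϖ, ← WithZero.exp_neg, ez, WithZero.exp_le_exp]; omega⟩
    rcases cover_arith hm hkm hrr hss hr1 hr2 hs1 hs2 hal hz0' hxx' hoff' hshal' with ⟨h1, h2, h3, h4, h5, h6, h7⟩ | ⟨hk1, h1, h2, h3, h4, h5⟩
    · -- family X with `c₁`
      obtain ⟨u, huN, hj, ε, hε, h00⟩ := exists_familyX_witness_twoDepth σ hJ hσ hvσ hvϖ r s r' s' Jg hJg hm hnb hrel hx1 hz1
        (by rw [eϖ, eϖ, ex, ← WithZero.exp_add, WithZero.exp_le_exp]; omega)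
        (by rw [eϖ, eϖ, ex, ez, ← WithZero.exp_add, ← WithZero.exp_add, WithZero.exp_le_exp]; omega)
        (by rw [eϖ, ex, ez, hvϖ, ← WithZero.exp_add, ← WithZero.exp_add, ← WithZero.exp_add, WithZero.exp_le_exp]; omega)
        h4 h5 h6 h7 hc₁ ht hvt
      exact ⟨u, huN, hj, c₁, ε, Or.inl rfl, hε, h00⟩
    · -- family Z with `c₂`
      obtain ⟨u, huN, hj, ε, hε, h00⟩ := exists_familyZ_witness_twoDepth σ hJ hσ hvσ hvϖ r s r' s' Jg hJg (m := m) hk1 hnb hrel hx1 hz1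
        (by rw [eϖ, eϖ, ez, ← WithZero.exp_add, WithZero.exp_le_exp]; omega)
        (by rw [eϖ, eϖ, ex, ez, ← WithZero.exp_add, ← WithZero.exp_add, WithZero.exp_le_exp]; omega)
        (by rw [eϖ, eϖ, ex, ← WithZero.exp_add, WithZero.exp_le_exp]; omega)
        (by rw [eϖ, eϖ, ez, ← WithZero.exp_add, WithZero.exp_le_exp]; omega)
        (by rw [eϖ, eϖ, ex, ez, ← WithZero.exp_add, ← WithZero.exp_add, ← WithZero.exp_add, WithZero.exp_le_exp]; omega)
        hσc₂ hc₂ ht hvt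
      exact ⟨u, huN, hj, c₂, ε, Or.inr rfl, hε, h00⟩

end Valuation

end Summit.HodgeConjecture.HodgeConjecture.Cruxes.H413.K2E3TwoDepthDepthWitnessCover

end
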